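import Literature.IUT.HodgeTheaters.PiAvatarThetaSlots
import Literature.IUT.HodgeTheaters.PiAvatarBaseKitThetaNF
import HarnessLib

/-!
# [IUTchI] Ex 4.4 / Prop 6.7 at the Θ-NF-kit: the FROZEN `MultKit`, `EvalBinder`, `KitCore` and law (γ) `KitCore.ThetaAgrees`
# INHABITED over the NF-widened Θ-kit `baseKitThetaNFOfData` (D-JΘ1-2 (iv-b′), file (C-NF) = file (C) re-run over J-NF-1's objects)

S. Mochizuki, *Inter-universal Teichmüller theory I*, kurims manuscript (May 2020), Example 4.4 (i)(ii)(iv) pp. 106–107, Proposition 6.7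
p. 167, Definition 6.1 (i) p. 156, Example 4.3 p. 99. ([IUTchI] Ex 4.4 (i) p.106) [claim: Mochizuki2012, status: disputed] (D-0012 claim key,
series status DISPUTED — kernel definitions/theorems about abc-iut's OWN kits and binders; nothing of the series is asserted; no side taken on
[IUTchIII] Cor. 3.12).

## What this file does

`PiAvatarThetaSlots` (file (C)) inhabits the frozen `EvalBinder`/`KitCore`/(γ) over the Θ-kit `baseKitThetaOfData` on the objects in play
`InPlay`; the NF kit `N` entering `KitCore` there is displayed data.  A GENUINE NF kit lives only over the NF-WIDENED objects `InPlayNF`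
(junction J-NF-1, abc-iut-L5-t3 p449994/p451329: `φ^NF_{•,v̲}` has no home in `InPlay`), i.e. over `baseKitThetaNFOfData`
(`PiAvatarBaseKitThetaNF`), where abc-iut-L5-t3's `nfKitThetaOfData` (file (D)) supplies it.  This file re-runs (C) verbatim over that kit:
`thetaFamilyNF`, `multKitThetaNF`, `evalBinderThetaNF` (FROZEN binder INHABITED), `thetaAgrees_baseKitThetaNF` (law (γ)),
`nonempty_kitCore_baseKitThetaNF`, `exists_kitCore_thetaAgrees_baseKitThetaNF` — binder `ES` (abc-iut-L5-t3 `EvalSectionBinder`) displayed,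
`N`, `B`, `5 ≤ l`, `bad ∩ arc = ∅`, `bad ≠ ∅` displayed as in `thetaAgrees_ofKit`.  NON-VACUITY reduces to that of `ES` (row «EVALSECT-NV») and
of `N` (file (D)).  «¬ IsIso» in `ThetaAmb` is by tag, not a statement about outer homomorphisms.  typed ≠ inhabited ≠ proved; binder ≠ fact.
-/

noncomputable section

namespace Literature.IUT.HodgeTheaters

open CategoryTheory

universe u v w

section ThetaNFSlots

variable {F : Type u} {K : Type v} {Fbar : Type w} [Field F] [NumberField F] [Field K] [NumberField K]
  [Algebra F K] [Field Fbar] [Algebra F Fbar] [Algebra K Fbar]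
  {E : WeierstrassCurve F} [E.IsElliptic] {l : ℕ} {Pb : BadPlacePredicates K}
  {D : InitialThetaData F K Fbar E l Pb} {CG : D.geom.pe.CuspGalois} {hS : D.CuspClassesNormaliserStable} [Fact l.Prime]

namespace InitialThetaData

/-! ### §2. The outer homomorphism of an automorphism of `𝒟_v̲` in the Θ-NF-kit is a normaliser conjugation -/

variable [(D.PiXund.subgroupOf D.PiXK).Normal] (hsurj : Function.Surjective D.toFlStarGlobal)
  {V : Type} [DecidableEq V] (bad arc : Finset V) (δ : V → D.LocalDatum CG hS)

/-- The outer homomorphism of an automorphism of `𝒟_v̲` in the Θ-NF-kit is `[h ↦ n⁻¹hn]` for some `n ∈ N(Π_v̲)` (isomorphisms are étale, and every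
automorphism of `ℬ(Π_v̲)⁰` in the orbit category is `xΠ_v̲ ↦ xnΠ_v̲`, `exists_eq_autOfNormalizer`). ([IUTchI] Def 6.1 (iii) p.157) [claim: Mochizuki2012, status: disputed] -/
theorem exists_out_hom_eq_ofConj_NF (v : V)
    (θ : (D.baseKitThetaNFOfData CG hS hsurj bad arc δ).model v ≅ (D.baseKitThetaNFOfData CG hS hsurj bad arc δ).model v) :
    ∃ (n : D.PiC) (hn : n ∈ Subgroup.normalizer (((δ v).H : Subgroup D.PiC) : Set D.PiC)),
      θ.hom.out = OuterHom.ofConj n (EvalSections.conj_mem_of_mem_normalizer hn) := by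
  obtain ⟨n, hn, he⟩ := OrbitCat.exists_eq_autOfNormalizer ((δ v).isoDownNF θ)
  refine ⟨n, hn, ?_⟩
  exact (θ.hom.etale_spec (ThetaAmb.deg_hom_eq_false θ)).trans
    ((congrArg OrbitCat.toOuter (congrArg Iso.hom he)).trans (OrbitCat.toOuter_homOfElem n _))

/-! ### §3. The `|𝔽_l|`-indexed degenerate classes of the Θ-NF-kit -/

variable {Gv : V → Subgroup (Fbar ≃ₐ[F] Fbar)} (ES : ∀ v, v ∈ bad → EvalSectionBinder (δ v) (Gv v))

/-- **The class of label `j ∈ |𝔽_l|` on the Θ-NF-kit's model at a bad index**: the DEGENERATE endomorphisms of `𝒟_v̲` whose outer homomorphism lies in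
`thetaClass j` (any transport datum). ([IUTchI] Ex 4.4 (ii) p.107) [claim: Mochizuki2012, status: disputed] -/
def thetaFamilyNF (v : V) (hv : v ∈ bad) (j : FlAbs l) :
    Set ((D.baseKitThetaNFOfData CG hS hsurj bad arc δ).model v ⟶ (D.baseKitThetaNFOfData CG hS hsurj bad arc δ).model v) :=
  {g | g.deg = true ∧ g.out ∈ (ES v hv).thetaClass j}

/-- Membership in `thetaFamilyNF`, unfolded. ([IUTchI] Ex 4.4 (ii) p.107) [claim: Mochizuki2012, status: disputed] -/
theorem mem_thetaFamilyNF_iff {v : V} {hv : v ∈ bad} {j : FlAbs l}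
    {g : (D.baseKitThetaNFOfData CG hS hsurj bad arc δ).model v ⟶ (D.baseKitThetaNFOfData CG hS hsurj bad arc δ).model v} :
    g ∈ D.thetaFamilyNF hsurj bad arc δ ES v hv j ↔ g.deg = true ∧ g.out ∈ (ES v hv).thetaClass j :=
  Iff.rfl

/-- **Every label occurs** (Ex 4.4 (i)): `⟨true, 𝟙, φ^Θ_{v̲_j}⟩ ∈ thetaFamilyNF j`. ([IUTchI] Ex 4.4 (i) p.107) [claim: Mochizuki2012, status: disputed] -/
theorem thetaFamilyNF_nonempty (v : V) (hv : v ∈ bad) (j : FlAbs l) : (D.thetaFamilyNF hsurj bad arc δ ES v hv j).Nonempty :=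
  ⟨ThetaAmb.degHom (𝟙 _) ((ES v hv).evalOuter j) ((ES v hv).isDegOver_evalOuter j),
    ⟨rfl, (ES v hv).evalOuter_mem_thetaClass j⟩⟩

/-- **Bi-saturation** (Ex 4.4 (ii) «composing with arbitrary isomorphisms»): `θ ≫ g ≫ β ∈ thetaFamilyNF j` for automorphisms `θ`, `β` of `𝒟_v̲`.
([IUTchI] Ex 4.4 (ii) p.107) [claim: Mochizuki2012, status: disputed] -/
theorem thetaFamilyNF_saturated (v : V) (hv : v ∈ bad) (j : FlAbs l)
    (θ β : (D.baseKitThetaNFOfData CG hS hsurj bad arc δ).model v ≅ (D.baseKitThetaNFOfData CG hS hsurj bad arc δ).model v)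
    {g : (D.baseKitThetaNFOfData CG hS hsurj bad arc δ).model v ⟶ (D.baseKitThetaNFOfData CG hS hsurj bad arc δ).model v}
    (hg : g ∈ D.thetaFamilyNF hsurj bad arc δ ES v hv j) : θ.hom ≫ g ≫ β.hom ∈ D.thetaFamilyNF hsurj bad arc δ ES v hv j := by
  refine ⟨?_, ?_⟩
  · have hdeg : (θ.hom ≫ g ≫ β.hom).deg = (θ.hom.deg || (g.deg || β.hom.deg)) := rfl
    rw [hdeg, hg.1, Bool.true_or, Bool.or_true]
  · obtain ⟨n, hn, hθ⟩ := D.exists_out_hom_eq_ofConj_NF hsurj bad arc δ v θ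
    obtain ⟨m, hm, hβ⟩ := D.exists_out_hom_eq_ofConj_NF hsurj bad arc δ v β
    have hout : (θ.hom ≫ g ≫ β.hom).out = (θ.hom.out.comp g.out).comp β.hom.out := (OuterHom.comp_assoc _ _ _).symm
    rw [hout, hθ, hβ]
    exact (ES v hv).ofConj_comp_comp_ofConj_mem_thetaClass hg.2 hn hm _ _

/-- **Label rigidity** (Ex 4.4 (iv)) on the Θ-NF-kit: if `g ∈ thetaFamilyNF j` and `θ ≫ g ≫ β ∈ thetaFamilyNF j′` then `j = j′` — from the binder's LAW
`label_rigid`. ([IUTchI] Ex 4.4 (iv) p.107) [claim: Mochizuki2012, status: disputed] -/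
theorem thetaFamilyNF_rigid (v : V) (hv : v ∈ bad) {j j' : FlAbs l}
    {g g' : (D.baseKitThetaNFOfData CG hS hsurj bad arc δ).model v ⟶ (D.baseKitThetaNFOfData CG hS hsurj bad arc δ).model v}
    (θ β : (D.baseKitThetaNFOfData CG hS hsurj bad arc δ).model v ≅ (D.baseKitThetaNFOfData CG hS hsurj bad arc δ).model v)
    (hg : g ∈ D.thetaFamilyNF hsurj bad arc δ ES v hv j) (hg' : g' ∈ D.thetaFamilyNF hsurj bad arc δ ES v hv j')
    (h : g' = θ.hom ≫ g ≫ β.hom) : j = j' := by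
  have h1 : g' ∈ D.thetaFamilyNF hsurj bad arc δ ES v hv j := h ▸ D.thetaFamilyNF_saturated hsurj bad arc δ ES v hv j θ β hg
  exact (ES v hv).label_rigid j j' ⟨g'.out, h1.2, hg'.2⟩

/-! ### §4. The FROZEN `MultKit` and `EvalBinder` shapes, inhabited -/

/-- **The multiplicative (§4-input) kit of the Θ-NF-kit generated by the evaluation sections**: `φ^Θ_{v̲_j} := thetaFamilyNF [j+1]` at the bad indices
(the FROZEN field `MultKit.thetaPolyBad`, typed in `Amb v` = `ThetaAmb`); the mono-analytic block is the tautological one-object groupoid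
(shape of `MultKit.trivialOf`; Def 4.1 (iv) plumbing only). ([IUTchI] Prop 6.7 p.167) [claim: Mochizuki2012, status: disputed] -/
def multKitThetaNF : (D.baseKitThetaNFOfData CG hS hsurj bad arc δ).MultKit where
  DMono := Discrete PUnit.{w + 1}
  mono _ := ⟨PUnit.unit⟩
  monoMap _ := 𝟙 _
  thetaPolyBad j v hv := D.thetaFamilyNF hsurj bad arc δ ES v hv (FlStar.toFlAbs l (FlStar.ofFin l j))

/-- `thetaPolyBad` of the Θ-NF-kit's multiplicative kit, unfolded (definitional). ([IUTchI] Ex 4.4 (i) p.107) [claim: Mochizuki2012, status: disputed] -/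
theorem multKitThetaNF_thetaPolyBad (j : Fin (lStar l)) (v : V) (hv : v ∈ bad) :
    (D.multKitThetaNF hsurj bad arc δ ES).thetaPolyBad j v hv = D.thetaFamilyNF hsurj bad arc δ ES v hv (FlStar.toFlAbs l (FlStar.ofFin l j)) :=
  rfl

/-- **The zero-labelled class** supplied to `polyOfLabel`: `thetaFamilyNF 0`. ([IUTchI] Ex 4.4 (i) p.107) [claim: Mochizuki2012, status: disputed] -/
def zeroSlotThetaNF (v : V) (hv : v ∈ bad) :
    Set ((D.baseKitThetaNFOfData CG hS hsurj bad arc δ).model v ⟶ (D.baseKitThetaNFOfData CG hS hsurj bad arc δ).model v) :=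
  D.thetaFamilyNF hsurj bad arc δ ES v hv (FlAbs.zero l)

variable (hl5 : 5 ≤ l)

/-- The `|𝔽_l|`-indexed family assembled by `polyOfLabel` from `multKitThetaNF` and `zeroSlotThetaNF` IS `thetaFamilyNF`.
([IUTchI] Ex 4.4 (i) p.107) [claim: Mochizuki2012, status: disputed] -/
theorem polyOfLabel_multKitThetaNF (v : V) (hv : v ∈ bad) (j : FlAbs l) :
    (D.multKitThetaNF hsurj bad arc δ ES).polyOfLabel hl5 (D.zeroSlotThetaNF hsurj bad arc δ ES) v hv j =
      D.thetaFamilyNF hsurj bad arc δ ES v hv j := by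
  obtain ⟨o, rfl⟩ : ∃ o, j = (flAbsEquivOption l).symm o := ⟨flAbsEquivOption l j, by simp⟩
  cases o with
  | none =>
    change (D.multKitThetaNF hsurj bad arc δ ES).polyOfLabel hl5 (D.zeroSlotThetaNF hsurj bad arc δ ES) v hv (FlAbs.zero l) = _
    rw [PMBaseKit.MultKit.polyOfLabel_zero]
    rfl
  | some s =>
    change (D.multKitThetaNF hsurj bad arc δ ES).polyOfLabel hl5 (D.zeroSlotThetaNF hsurj bad arc δ ES) v hv (FlStar.toFlAbs l s) =
      D.thetaFamilyNF hsurj bad arc δ ES v hv (FlStar.toFlAbs l s)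
    obtain ⟨i, rfl⟩ := (FlStar.ofFin_bijective l (PMBaseKit.MultKit.two_ne_of_five_le hl5)).2 s
    rw [PMBaseKit.MultKit.polyOfLabel_ofFin]
    rfl

/-- Input `hne` of `MultKit.evalBinder`: every class is nonempty. ([IUTchI] Ex 4.4 (i) p.107) [claim: Mochizuki2012, status: disputed] -/
theorem hne_multKitThetaNF (v : V) (hv : v ∈ bad) (j : FlAbs l) :
    ((D.multKitThetaNF hsurj bad arc δ ES).polyOfLabel hl5 (D.zeroSlotThetaNF hsurj bad arc δ ES) v hv j).Nonempty := by
  rw [D.polyOfLabel_multKitThetaNF hsurj bad arc δ ES hl5]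
  exact D.thetaFamilyNF_nonempty hsurj bad arc δ ES v hv j

/-- Input `hrig` of `MultKit.evalBinder`: the labels are rigid. ([IUTchI] Ex 4.4 (iv) p.107) [claim: Mochizuki2012, status: disputed] -/
theorem hrig_multKitThetaNF (v : V) (hv : v ∈ bad) {j j' : FlAbs l}
    {g g' : (D.baseKitThetaNFOfData CG hS hsurj bad arc δ).model v ⟶ (D.baseKitThetaNFOfData CG hS hsurj bad arc δ).model v}
    (θ β : (D.baseKitThetaNFOfData CG hS hsurj bad arc δ).model v ≅ (D.baseKitThetaNFOfData CG hS hsurj bad arc δ).model v)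
    (hg : g ∈ (D.multKitThetaNF hsurj bad arc δ ES).polyOfLabel hl5 (D.zeroSlotThetaNF hsurj bad arc δ ES) v hv j)
    (hg' : g' ∈ (D.multKitThetaNF hsurj bad arc δ ES).polyOfLabel hl5 (D.zeroSlotThetaNF hsurj bad arc δ ES) v hv j')
    (h : g' = θ.hom ≫ g ≫ β.hom) : j = j' := by
  rw [D.polyOfLabel_multKitThetaNF hsurj bad arc δ ES hl5] at hg hg'
  exact D.thetaFamilyNF_rigid hsurj bad arc δ ES v hv θ β hg hg' h

/-- Input `hsat` of `thetaAgrees_ofKit`: the kit's `φ^Θ_{v̲_j}` are bi-saturated. ([IUTchI] Ex 4.4 (ii) p.107) [claim: Mochizuki2012, status: disputed] -/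
theorem hsat_multKitThetaNF (v : V) (hv : v ∈ bad) (j : Fin (lStar l))
    (θ β : (D.baseKitThetaNFOfData CG hS hsurj bad arc δ).model v ≅ (D.baseKitThetaNFOfData CG hS hsurj bad arc δ).model v)
    {g : (D.baseKitThetaNFOfData CG hS hsurj bad arc δ).model v ⟶ (D.baseKitThetaNFOfData CG hS hsurj bad arc δ).model v}
    (hg : g ∈ (D.multKitThetaNF hsurj bad arc δ ES).thetaPolyBad j v hv) :
    θ.hom ≫ g ≫ β.hom ∈ (D.multKitThetaNF hsurj bad arc δ ES).thetaPolyBad j v hv :=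
  D.thetaFamilyNF_saturated hsurj bad arc δ ES v hv _ θ β hg

/-- **THE FROZEN EVALUATION-SECTION BINDER `EvalBinder`, INHABITED over the Θ-NF-kit** — generated by the evaluation sections through the frozen
constructor `MultKit.evalBinder` (Example 4.4 (i)(ii)(iv)); compare `isEmpty_evalBinder_baseKitOfData_of_isClosed` (p456090) at the D13 kits.
([IUTchI] Ex 4.4 (i) p.106) [claim: Mochizuki2012, status: disputed] -/
def evalBinderThetaNF : (D.baseKitThetaNFOfData CG hS hsurj bad arc δ).EvalBinder :=
  (D.multKitThetaNF hsurj bad arc δ ES).evalBinder hl5 (D.zeroSlotThetaNF hsurj bad arc δ ES)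
    (D.hne_multKitThetaNF hsurj bad arc δ ES hl5) (fun v hv _ _ _ _ θ β hg hg' h => D.hrig_multKitThetaNF hsurj bad arc δ ES hl5 v hv θ β hg hg' h)

include ES hl5 in
/-- NV: the frozen binder over the Θ-NF-kit is NONEMPTY as soon as the evaluation-section binders are given.
([IUTchI] Ex 4.4 (i) p.106) [claim: Mochizuki2012, status: disputed] -/
theorem nonempty_evalBinder_baseKitThetaNF : Nonempty (D.baseKitThetaNFOfData CG hS hsurj bad arc δ).EvalBinder :=
  ⟨D.evalBinderThetaNF hsurj bad arc δ ES hl5⟩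

/-- The evaluation sections of the inhabited binder between the model objects are the degenerate classes (unfolded).
([IUTchI] Ex 4.4 (ii) p.107) [claim: Mochizuki2012, status: disputed] -/
theorem evalBinderThetaNF_isEvalSection_iff {v : V} (hv : v ∈ bad) (j : FlAbs l)
    {X Y : (D.baseKitThetaNFOfData CG hS hsurj bad arc δ).LocalObj v} (f : X.obj ⟶ Y.obj) :
    (D.evalBinderThetaNF hsurj bad arc δ ES hl5).IsEvalSection hv j f ↔
      ∃ (a : X.obj ≅ (D.baseKitThetaNFOfData CG hS hsurj bad arc δ).model v) (b : (D.baseKitThetaNFOfData CG hS hsurj bad arc δ).model v ≅ Y.obj)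
        (g : (D.baseKitThetaNFOfData CG hS hsurj bad arc δ).model v ⟶ (D.baseKitThetaNFOfData CG hS hsurj bad arc δ).model v),
        g ∈ D.thetaFamilyNF hsurj bad arc δ ES v hv j ∧ f = a.hom ≫ g ≫ b.hom := by
  change PMBaseKit.IsSaturatedSection _ hv j f ↔ _
  unfold PMBaseKit.IsSaturatedSection
  rw [D.polyOfLabel_multKitThetaNF hsurj bad arc δ ES hl5]

/-! ### §5. The FROZEN `KitCore` and law (γ) `ThetaAgrees` over the Θ-NF-kit -/

variable (hba : ∀ x ∈ (D.baseKitThetaNFOfData CG hS hsurj bad arc δ).bad, x ∉ (D.baseKitThetaNFOfData CG hS hsurj bad arc δ).arc)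
  (hb : (D.baseKitThetaNFOfData CG hS hsurj bad arc δ).bad.Nonempty)
  (N : (D.baseKitThetaNFOfData CG hS hsurj bad arc δ).NFKit) (B : (D.baseKitThetaNFOfData CG hS hsurj bad arc δ).MonoBinder)

/-- **Law (γ) `KitCore.ThetaAgrees` HOLDS over the Θ-NF-kit** for the identity dictionary `KitCore.ofKit` of the §4 datum `BaseThetaDatum.ofKitCore` built from
the Θ-NF-kit, its NF kit `N`, a mono-analytic binder `B` and the inhabited evaluation-section binder: Prop 6.7's «the kit's `φ^Θ_{v_j}` IS Example 4.4's
`φ^Θ_{v_j}`», by abc-iut-L5-t3's `thetaAgrees_ofKit` and `hsat_multKitThetaNF`. NON-VACUOUS modulo the displayed data (contrast p456090 at D13).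
([IUTchI] Prop 6.7 p.167) [claim: Mochizuki2012, status: disputed] -/
theorem thetaAgrees_baseKitThetaNF :
    (BaseThetaDatum.KitCore.ofKit (D.baseKitThetaNFOfData CG hS hsurj bad arc δ) hl5 hba hb N B
        (D.evalBinderThetaNF hsurj bad arc δ ES hl5)).ThetaAgrees (D.multKitThetaNF hsurj bad arc δ ES) :=
  BaseThetaDatum.thetaAgrees_ofKit _ hl5 hba hb N B _ _ _ _ (fun v hv j θ β _ hg => D.hsat_multKitThetaNF hsurj bad arc δ ES v hv j θ β hg)

/-- **The FROZEN core agreement `KitCore` is INHABITED over the Θ-NF-kit** (with the §4 datum built from it) — contrast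
`isEmpty_kitCore_baseKitOfData_of_isClosed` (p456090) at the D13 kits. ([IUTchI] Def 6.1 (i) p.156) [claim: Mochizuki2012, status: disputed] -/
theorem nonempty_kitCore_baseKitThetaNF :
    Nonempty ((BaseThetaDatum.ofKitCore (D.baseKitThetaNFOfData CG hS hsurj bad arc δ) hl5 hba hb N B
      (D.evalBinderThetaNF hsurj bad arc δ ES hl5)).KitCore (D.baseKitThetaNFOfData CG hS hsurj bad arc δ)) :=
  ⟨BaseThetaDatum.KitCore.ofKit _ hl5 hba hb N B _⟩

include ES in
/-- **There EXIST an evaluation-section binder, a core agreement and a multiplicative kit over the Θ-NF-kit satisfying law (γ)** — the existential form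
the CERT bank may cite (binders displayed: `ES`, `N`, `B`, `hl5`, `hba`, `hb`). ([IUTchI] Prop 6.7 p.167) [claim: Mochizuki2012, status: disputed] -/
theorem exists_kitCore_thetaAgrees_baseKitThetaNF :
    ∃ (Ev : (D.baseKitThetaNFOfData CG hS hsurj bad arc δ).EvalBinder)
      (c : (BaseThetaDatum.ofKitCore (D.baseKitThetaNFOfData CG hS hsurj bad arc δ) hl5 hba hb N B Ev).KitCore
        (D.baseKitThetaNFOfData CG hS hsurj bad arc δ))
      (M : (D.baseKitThetaNFOfData CG hS hsurj bad arc δ).MultKit), c.ThetaAgrees M :=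
  ⟨_, _, _, D.thetaAgrees_baseKitThetaNF hsurj bad arc δ ES hl5 hba hb N B⟩

end InitialThetaData

end ThetaNFSlots

end Literature.IUT.HodgeTheaters
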